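import Mathlib.Topology.DenseEmbedding
import Literature.AnabelianGeometry.AbsoluteAnabelian.AbsTopIProp410Sub
import HarnessLib

/-!
# [AbsTopI] Prop 4.10 (i)/(iii): what the reconstruction statements force — density, uniqueness,
# kernels (proof-only companion to `AbsTopIProp410Sub.lean`)

S. Mochizuki, *Topics in Absolute Anabelian Geometry I: Generalities* [AbsTopI] (J. Math. Sci.
Univ. Tokyo 19 (2012)), manuscript pagination (lit key `paper:url-11ac98ba15fc`), read on the page:

* §0 p. 8: "Thus, we have a natural dense homomorphism `Π → Π^{Q/co-fr}`."
* Prop 4.10 (i) p. 60: "`π₁^tp(X)` [...] is naturally isomorphic to its `π₁(X)`-co-free completion".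
* Prop 4.10 (iii) p. 60: "the natural homomorphism `Π^tp_X → Π^tp_Y` [...] may be reconstructed —
  "group-theoretically" — from its profinite completion `Π̂^tp_X ↠ Π̂^tp_Y` [...] as the natural
  morphism from `Π^tp_X` [...] to the co-free completion of `Π^tp_X` with respect to `Π̂^tp_Y`".
* Def 4.11 (i)(c) pp. 62–63 (the TEMPERED elementary operation of type `•`): "a dense homomorphism
  `φ : Π_j → Π_{j+1}` which is isomorphic to the co-free completion of `Π_j` with respect to the
  induced profinite quotient `φ̂ : Π̂_j ↠ Π̂_{j+1}`" — as opposed to the PROFINITE clause Def 4.2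
  (iii)(c) p. 50 "a surjection of profinite groups `φ : Π_j ↠ Π_{j+1}`".

abc-iut-w5-d025's statements-first sub-DAG (`AbsTopIProp410Sub.lean`, p414417) types (iii) as
`Prop410iii E kitX := ∃ e : kitX.C ≃ₜ* Π^tp_Y, ∀ g, e (η g) = f g` over a kit `kitX` of OUTPUTS of
the co-free completion, and (i)'s last clause as `SelfCompletion`.  This file PROVES, at that
generality (any kit; the construction's kit has dense `η` by
`AbsTopI.denseRange_toCoFreeCompletion`, abc-iut-L4-t13 p416051):

* `Prop410iii.denseRange_f` — (iii) + "`η` dense" ⟹ the tempered `f : Π^tp_X → Π^tp_Y` is DENSE: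
  the printed adjective of Def 4.11 (i)(c) is a CONSEQUENCE of the typed node;
* `Prop410iii.surjective_f_iff` — under (iii), "`f` surjective" ⟺ "`η : Π → Π^{Q/co-fr}`
  surjective": the surjectivity conjunct of row iii.L03 `DeCuspidalization.Surjective` is
  EQUIVALENT to surjectivity of §0's dense map, which print does not assert (audit input for
  finding F-w5d011-1's sibling on iii.L03; no side taken on whether it holds at intended data);
* `Prop410iii.unique`, `SelfCompletion.unique` — the reconstructing isomorphism is UNIQUE
  (density + `Π^tp` Hausdorff, `TemperedCurve.t2Space_piTemp` from `toHat_injective` into the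
  profinite `Π̂`): "may be reconstructed" names ONE isomorphism;
* `Prop410iii.ker_eq`, `selfCompletion_iff_isHomeomorph` — (iii) identifies `Ker f` with `Ker η`;
  (i)'s last clause holds at a kit iff its `η` is a homeomorphism (so at the construction it is the
  statement "`Π^tp → (Π^tp)^{Π̂/co-fr}` is an isomorphism of topological groups", an input about
  temperedness = abc-iut-L3's interface, cf. abc-iut-w5-d011 2026-08-26T01:50:25Z (ii)).

HONEST FRAMING: refereed prerequisite paper; typed ≠ proved for the nodes themselves (they stay
named `Prop`s); nothing here bears on [IUTchIII] Cor 3.12.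
-/

noncomputable section

open Topology

namespace Literature.AnabelianGeometry.AbsoluteAnabelian.AbsTopI.Prop410

open Literature.AnabelianGeometry.SemiGraphs

variable {p : ℕ} [Fact p.Prime]

/-! ### `Π^tp` is Hausdorff -/

/-- `Π^tp_X` is Hausdorff: it injects continuously (`toHat`, "natural injection", [SemiAnbd] §6
p. 69 / [AbsTopI] Prop 4.10 (i)) into the profinite, hence Hausdorff, `Π̂_X`.
[cite: MochizukiAbsTopI2012, Prop 4.10 (i) p.60] -/
theorem _root_.Literature.AnabelianGeometry.SemiGraphs.TemperedCurve.t2Space_piTemp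
    (X : TemperedCurve p) : T2Space X.PiTemp :=
  haveI := X.isProfiniteCompletion_toHat.t2Space
  T2Space.of_injective_continuous X.toHat_injective X.toHat.continuous

/-! ### Prop 4.10 (iii): consequences of the typed node -/

namespace Prop410iii

variable {X Y : TemperedCurve p} {E : DeCuspidalization X Y} {kitX : CoFreeQKit X Y.PiHat E.fHat}

/-- Under (iii), `f = e ∘ η` as functions. [cite: MochizukiAbsTopI2012, Prop 4.10 (iii) p.60] -/
theorem f_eq_comp (e : kitX.C ≃ₜ* Y.PiTemp) (he : ∀ g : X.PiTemp, e (kitX.η g) = E.f g) :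
    (E.f : X.PiTemp → Y.PiTemp) = e ∘ kitX.η :=
  funext fun g => (he g).symm

/-- **(iii) ⟹ `f` is DENSE** whenever the kit's `η` is dense (§0 p. 8 "natural dense
homomorphism"; at the construction: `AbsTopI.denseRange_toCoFreeCompletion`): the printed "dense
homomorphism" of Def 4.11 (i)(c) pp. 62–63 is a consequence of the reconstruction statement.
[cite: MochizukiAbsTopI2012, Def 4.11 (i)(c) p.62] -/
theorem denseRange_f (h : Prop410iii E kitX) (hη : DenseRange kitX.η) : DenseRange E.f := by
  obtain ⟨e, he⟩ := h
  rw [f_eq_comp e he]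
  exact e.surjective.denseRange.comp hη e.continuous

/-- Under (iii): `f` is surjective iff the kit's `η : Π^tp_X → (Π^tp_X)^{Π̂_Y/co-fr}` is surjective —
the surjectivity conjunct of row iii.L03 (`DeCuspidalization.Surjective`) is equivalent to
surjectivity of §0's dense map, a claim print does not make (§0 p. 8 says "dense"; Def 4.11 (i)(c)
says "dense homomorphism"). [cite: MochizukiAbsTopI2012, §0 p.8] -/
theorem surjective_f_iff (h : Prop410iii E kitX) :
    Function.Surjective E.f ↔ Function.Surjective kitX.η := by
  obtain ⟨e, he⟩ := h
  rw [f_eq_comp e he]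
  constructor
  · intro hs
    exact Function.Surjective.of_comp_left hs e.injective
  · intro hs
    exact e.surjective.comp hs

/-- Under (iii): `Ker f = Ker η` — the reconstruction recovers the kernel of the natural
homomorphism. [cite: MochizukiAbsTopI2012, Prop 4.10 (iii) p.60] -/
theorem ker_eq (h : Prop410iii E kitX) : E.f.toMonoidHom.ker = kitX.η.toMonoidHom.ker := by
  obtain ⟨e, he⟩ := h
  ext g
  rw [MonoidHom.mem_ker, MonoidHom.mem_ker]
  change E.f g = 1 ↔ kitX.η g = 1
  rw [← he g, EmbeddingLike.map_eq_one_iff]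

/-- Under (iii): the image of `f` is the image under `e` of the image of `η`.
[cite: MochizukiAbsTopI2012, Prop 4.10 (iii) p.60] -/
theorem range_eq (e : kitX.C ≃ₜ* Y.PiTemp) (he : ∀ g : X.PiTemp, e (kitX.η g) = E.f g) :
    E.f.toMonoidHom.range = kitX.η.toMonoidHom.range.map e.toMulEquiv.toMonoidHom := by
  ext y
  constructor
  · rintro ⟨g, rfl⟩
    exact ⟨kitX.η g, ⟨g, rfl⟩, he g⟩
  · rintro ⟨_, ⟨g, rfl⟩, rfl⟩
    exact ⟨g, (he g).symm⟩

/-- **Uniqueness of the reconstruction**: if the kit's `η` is dense, at most ONE isomorphism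
`(Π^tp_X)^{Π̂_Y/co-fr} ≃ₜ* Π^tp_Y` carries `η` to `f` (two continuous maps into the Hausdorff
`Π^tp_Y` agreeing on the dense image of `η` agree). [cite: MochizukiAbsTopI2012, Prop 4.10 (iii) p.60] -/
theorem unique (hη : DenseRange kitX.η) (e e' : kitX.C ≃ₜ* Y.PiTemp)
    (he : ∀ g : X.PiTemp, e (kitX.η g) = E.f g) (he' : ∀ g : X.PiTemp, e' (kitX.η g) = E.f g) :
    e = e' := by
  haveI := Y.t2Space_piTemp
  have hfun : (e : kitX.C → Y.PiTemp) = e' :=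
    hη.equalizer e.continuous e'.continuous (funext fun g => (he g).trans (he' g).symm)
  exact ContinuousMulEquiv.ext fun c => congr_fun hfun c

/-- Under (iii) with dense `η`: the reconstructing isomorphism exists UNIQUELY.
[cite: MochizukiAbsTopI2012, Prop 4.10 (iii) p.60] -/
theorem existsUnique (h : Prop410iii E kitX) (hη : DenseRange kitX.η) :
    ∃! e : kitX.C ≃ₜ* Y.PiTemp, ∀ g : X.PiTemp, e (kitX.η g) = E.f g := by
  obtain ⟨e, he⟩ := h
  exact ⟨e, he, fun e' he' => unique hη e' e he' he⟩

end Prop410iii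

/-- (iii) for `Δ^tp` carries the same isomorphism, hence the same consequences: density of `f`.
[cite: MochizukiAbsTopI2012, Prop 4.10 (iii) p.60] -/
theorem Prop410iiiDelta.prop410iii {X Y : TemperedCurve p} {E : DeCuspidalization X Y}
    {kitX : CoFreeQKit X Y.PiHat E.fHat} (h : Prop410iiiDelta E kitX) : Prop410iii E kitX := by
  obtain ⟨e, he, _⟩ := h
  exact ⟨e, he⟩

/-! ### Prop 4.10 (i), last clause: `SelfCompletion` -/

namespace SelfCompletion

variable {Z : TemperedCurve p} {kit : CoFreeQKit Z Z.PiHat (ContinuousMonoidHom.id Z.PiHat)}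

/-- Under (i)'s last clause, `η` followed by the isomorphism is the identity: `e ∘ η = id`.
[cite: MochizukiAbsTopI2012, Prop 4.10 (i) p.60] -/
theorem comp_eq_id (e : kit.C ≃ₜ* Z.PiTemp) (he : ∀ g : Z.PiTemp, e (kit.η g) = g) :
    (e : kit.C → Z.PiTemp) ∘ kit.η = id :=
  funext he

/-- Under (i)'s last clause, `η = e⁻¹`; in particular `η` is bijective.
[cite: MochizukiAbsTopI2012, Prop 4.10 (i) p.60] -/
theorem η_eq_symm (e : kit.C ≃ₜ* Z.PiTemp) (he : ∀ g : Z.PiTemp, e (kit.η g) = g) (g : Z.PiTemp) :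
    kit.η g = e.symm g := by
  rw [← he g, e.symm_apply_apply, he g]

/-- **(i)'s last clause at a kit ⟺ its `η` is a homeomorphism** (then automatically an isomorphism
of topological groups): "`π₁^tp(X)` is naturally isomorphic to its `π₁(X)`-co-free completion" says
exactly that the natural dense homomorphism of §0 is an isomorphism.
[cite: MochizukiAbsTopI2012, Prop 4.10 (i) p.60] -/
theorem _root_.Literature.AnabelianGeometry.AbsoluteAnabelian.AbsTopI.Prop410.selfCompletion_iff_isHomeomorph :
    SelfCompletion Z kit ↔ IsHomeomorph kit.η := by
  constructor
  · rintro ⟨e, he⟩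
    have hη : (kit.η : Z.PiTemp → kit.C) = e.symm := funext (η_eq_symm e he)
    rw [hη]
    exact e.symm.toHomeomorph.isHomeomorph
  · intro hη
    let φ : Z.PiTemp ≃ₜ kit.C := hη.homeomorph kit.η
    have hφ : ∀ g, φ g = kit.η g := fun _ => rfl
    let e₀ : kit.C ≃* Z.PiTemp :=
      { toFun := φ.symm
        invFun := φ
        left_inv := fun c => φ.apply_symm_apply c
        right_inv := fun g => φ.symm_apply_apply g
        map_mul' := fun a b => by
          apply φ.injective
          rw [φ.apply_symm_apply, hφ (φ.symm a * φ.symm b), map_mul, ← hφ, ← hφ,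
            φ.apply_symm_apply, φ.apply_symm_apply] }
    let e : kit.C ≃ₜ* Z.PiTemp :=
      { e₀ with
        continuous_toFun := φ.symm.continuous
        continuous_invFun := φ.continuous }
    refine ⟨e, fun g => ?_⟩
    change φ.symm (kit.η g) = g
    rw [← hφ, φ.symm_apply_apply]

/-- Uniqueness of the isomorphism in (i)'s last clause, for dense `η`.
[cite: MochizukiAbsTopI2012, Prop 4.10 (i) p.60] -/
theorem unique (hη : DenseRange kit.η) (e e' : kit.C ≃ₜ* Z.PiTemp)
    (he : ∀ g : Z.PiTemp, e (kit.η g) = g) (he' : ∀ g : Z.PiTemp, e' (kit.η g) = g) : e = e' := by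
  haveI := Z.t2Space_piTemp
  have hfun : (e : kit.C → Z.PiTemp) = e' :=
    hη.equalizer e.continuous e'.continuous (funext fun g => (he g).trans (he' g).symm)
  exact ContinuousMulEquiv.ext fun c => congr_fun hfun c

end SelfCompletion

end Literature.AnabelianGeometry.AbsoluteAnabelian.AbsTopI.Prop410
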